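import Summits.Parity.GeneralizedHardyLittlewood.Theorems.PrimeLevelFamEdgeIdeaDeltasFamilyDefs
import Literature.NumberTheory.LFunctions.KMVMomentAsymptoticsLogWindow
import Literature.NumberTheory.LFunctions.KMVDiagonalSlack

/-!
# Route `PrimeLevelFamEdge` — TYPED IDEA DELTAS against the door U-d, deck 6: THE SLIVER
(cell ls-idea, second wave: cards K-I8-7 «the sliver is two-branch too», K-I8-6 «the Goldfeld–Schinzel
dial», K6-4 «three lines across the diagonal»; cluster SLIVER/LOG-WINDOW {K6-1, K6-4, K-I8-7} and the
(A)-BRANCH INSTRUMENT parameter K-I8-6 of `CARDS.md` §1b)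

PROOF-FREE `def … : Prop` deltas (idea cards that passed critics A and B; critic C's successor verdicts
pending at typing time), stated in the tree's KMV2000 vocabulary against K6-1's log-window door
`PrimeLevelFamEdgeIdeaDeltas.LogWindowUpperControl B η` (deck 2 §1, p553389) and
`KMV2000.MomentAsymptoticsLogWindow` (p553539), plus KERNEL glue where it is bookkeeping; otherwise
«glue: CLAIMED, gap = …». Imports: deck 2 (for `logWindowExponent` / `LogWindowUpperControl`) +
Literature only. NOTHING HERE IS ASSERTED: every `def … : Prop` is a hypothesis SHAPE with the card's
parameters explicit; «typed ≠ proved; no exceptional-zero theorem (no Landau–Siegel exclusion, no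
Theorem 1–2 of arXiv:2211.02515, no repaired Margin232) is proved by ideation». Card texts / critic
verdicts: `run/shared/lean/pub/ls-idea/CARDS.md`, `cards/ls-idea-lens-{6,8}.md`,
`ls-idea-ref-{1,2,3}/card-verdicts.md`; sketches `ls-idea-lens-8/Sketch_{Dial,SliverTwoBranch}.lean`.
-/

noncomputable section

namespace Summit.Parity.GeneralizedHardyLittlewood.Theorems.PrimeLevelFamEdgeIdeaDeltas

open Polynomial Filter Finset
open Literature.NumberTheory.LFunctions
open Literature.NumberTheory.LFunctions.KMV2000
open Summit.Parity.GeneralizedHardyLittlewood.Theses.PrimeLevelFamEdge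

/-! ## §1 K-I8-7 «THE SLIVER IS TWO-BRANCH TOO — D-TORSION ARCS» (lens-8 gen 1; critics A PASS as
STRUCTURE = door-ledger correction, survives its own F1 in the tree · B PASS, ledger correction accepted ·
C pending). The printed-shape half (`KMV2000.MomentAsymptoticsLogWindowLevelDep/TwoBranch`) is the
Literature file `KMVMomentAsymptoticsLogWindowTwoBranch.lean`; here: the (A)-world negative-knowledge
Prop, the log-window twin of deck 2 §5 `AWorldKillsLevelFreeKA`. -/

/-- **K-I8-7, PIN P-R1′ IN THE SLIVER (shape, NOT asserted).** Mechanism (card): transport the door's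
forced split (K-I8-3: at COMPATIBLE prime levels `q₊ ∈ [D^{A₁}, D^{A₂}]` in the (A)-world the true second
table exceeds the principal one by `≥ (1 − o(1))·slack`) to K6-1's log window
`Δ'_q = 1 + B·log log q̂/log q̂` (slack `≍ (4 − η)(Δ'_q − 1)`, the `LogWindowUpperControl` band), using that
the consumer edge is LINEAR in the excess (`CentralValueFamily.lOne_lowerBound_of_EStarFamLog`, p553194 —
the card's decisive falsifier F1, answered YES in the tree); locate WHERE the exceptional level dependence
sits when `D` exceeds the visible conductor range `H = (log q̂)^{B/2}`: inside the «minor» remainder, on the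
D-torsion Kloosterman arcs (the mollifier's exponential sum has secondary major arcs at denominator `D`,
`S(b/D) = τ(χ_D)χ_D(b)φ(D)⁻¹ M^{1/2} R_{χ_D}(M) + generic`, amplitude `∝ σ_D^{−2}` = K-I8-6's dial).
EMITS the ledger correction «(I)^{sliver} = "R_minor = o(slack) at all large prime levels" is
Landau–Siegel-complete, not lemma-sized», i.e. THIS Prop: Siegel zeros of quality `≥ η₀` at arbitrarily
large conductor refute EVERY level-free log-window table at width `B` (so the honest sliver door is the
two-branch shape `KMV2000.MomentAsymptoticsLogWindowTwoBranch`). Controls: U-d K_A in log-window form,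
door-ledger line (I); G-24 C4′ (slack). Why novel (card; critics A/B): no seat or print places the
exceptional term inside R_minor for `D > H`; searches null (vsearch/galaxy/fts ids on the card).
Falsifiers: F1 (tree, passed), F2 (orthogonality identity, nothing to compute). A PREDICATE in
`(η₀, B)`; NOT ASSERTED (the card argues it from the door's contrapositive PLUS K6-1's hidden input
«twisted half at rate»); typed ≠ proved.
[cite: IwaniecConversations2006, §9 (9.6) and §7 p. 97] [cite: KowalskiMichelVanderKam2000, p. 28 L73–L77] -/
def AWorldKillsLevelFreeKALog (η₀ B : ℝ) : Prop :=
  (∀ q₀ : ℕ, ∃ (q : ℕ) (_ : NeZero q) (χ : DirichletCharacter ℂ q) (η : ℝ),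
      q₀ ≤ q ∧ η₀ ≤ η ∧ Literature.Barriers.Parity.IsSiegelZero χ η) →
    ∀ T₁ T₂ : ℝ → ℝ[X] → ℝ[X] → ℝ, ¬ MomentAsymptoticsLogWindow B T₁ T₂

/-- Bookkeeping (proved): the kill statement is MONOTONE in the quality — fewer hypothetical Siegel zeros
(higher quality `η₀' ≥ η₀`) are needed by a weaker claim, so `AWorldKillsLevelFreeKALog η₀ B` implies it
at every `η₀' ≥ η₀`. [cite: IwaniecConversations2006, §9 (9.6)] -/
theorem AWorldKillsLevelFreeKALog.mono {η₀ η₀' B : ℝ} (h : AWorldKillsLevelFreeKALog η₀ B)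
    (hη : η₀ ≤ η₀') : AWorldKillsLevelFreeKALog η₀' B := by
  intro hS T₁ T₂
  refine h (fun q₀ ↦ ?_) T₁ T₂
  obtain ⟨q, hq, χ, η, hq₀, hη₀, hz⟩ := hS q₀
  exact ⟨q, hq, χ, η, hq₀, le_trans hη hη₀, hz⟩

/-- Bookkeeping (proved): under the tree's registered OPEN statement `UnboundedSiegelZeros` (Siegel zeros
of every quality at arbitrarily large conductor), the kill statement at ANY quality refutes every
level-free log-window table — the circularity-certificate direction «a level-free sliver K_A proved would
refute `UnboundedSiegelZeros`». [cite: IwaniecConversations2006, §9 (9.6)] -/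
theorem not_momentAsymptoticsLogWindow_of_unboundedSiegelZeros {η₀ B : ℝ}
    (h : AWorldKillsLevelFreeKALog η₀ B) (hU : Literature.Barriers.Parity.UnboundedSiegelZeros)
    (T₁ T₂ : ℝ → ℝ[X] → ℝ[X] → ℝ) : ¬ MomentAsymptoticsLogWindow B T₁ T₂ :=
  h (unboundedSiegelZeros_iff_forall_antecedent.1 hU η₀) T₁ T₂

/-! ## §2 K-I8-6 «THE GOLDFELD–SCHINZEL DIAL» (lens-8 gen 1; critics A PASS as INSTRUMENT-AUDIT /
STRUCTURE (the exceptional-branch table gains its parameter σ_D, census R-38) · B PASS as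
INSTRUMENT-PARAMETER, safe typed form (d) two-sided · C pending). Shapes from the author's sketch
`Sketch_Dial.lean` (sha16 ea87564eb3170e04, rc 0), plus the conditional by-product (β) as a shape. -/

/-- **K-I8-6: the split-prime harmonic mass** `Σ_{p ≤ x, p prime} (1 + Re χ(p))/p` of a Dirichlet
character up to `x` (for real `χ` this is the Granville–Soundararajan distance `𝔻(χ, μ; x)²` up to the
ramified primes; the card's «dial reading» on family scales). A DEFINITION (lens-8 sketch `splitMass`).
[cite: MontgomeryVaughan2007, §11.2 p. 277] -/
def splitMass {D : ℕ} (χ : DirichletCharacter ℂ D) (x : ℕ) : ℝ :=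
  ∑ p ∈ Nat.primesBelow (x + 1), (1 + (χ (p : ZMod D)).re) / (p : ℝ)

/-- **K-I8-6 DIAL LEMMA (shape; the card's elementary two-sided form (d), NOT proved here).** For real
primitive `χ mod D` with `L(1,χ)·(10·C₁·log D) ≤ 1`, on every family scale `D^{1+ε} ≤ x ≤ D^{C₁}` the split
mass equals `log L'(1,χ)` up to a constant `C(ε, C₁)`. Mechanism (card): `σ_D := Σ'_{(a,b,c) reduced} 1/a`
and Goldfeld–Schinzel 1975 Thm 1 «`1 − β = (6/π²)·L(1,χ_D)/σ_D·(1 + o(1))`» make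
`L'(β,χ_D) = L'(1,χ_D)(1+o(1)) = (π²/6)σ_D(1+o(1))` under (A)_A, `A > 3`; the DIAL LEMMA (hyperbola method
for `Σ_{n≤x}(1∗χ)(n)/n = L(1,χ)(log x + γ) + L'(1,χ) + O(1 + √D log D log x/x)`, positivity of `1∗χ`,
Rankin; no zero needed) reads the dial `log L'(1,χ_D) = log σ_D + O(1)` off the primes. EMITS: (i) the
exceptional resonance amplitude in ANY mollified family `R_{χ_D}(M) = c_P M^{β−1}/L'(β,χ_D)(1+o(1))`, so
every exceptional main term scales with `σ_D^{−2}` unless a σ-free companion exists; (ii) the DIAL RANGE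
under (A): free between the HEEGNER POLE (`σ_D ≍ 1`) and the SPLIT-HEAVY POLE
(`σ_D ≍ (log D)²(lll D)²/(4(A+1)²(ll D)²)`); (iii) the DIAL-INVARIANCE AUDIT RULE for the (A)-instrument
cluster {K6-3, K4-2, K-I8-1, K5-2}: report the exceptional term as a function of `(β, σ_D)` and test the
door at BOTH poles. Controls: U-d K_A2's exceptional table (`MomentAsymptoticsTwoBranch` /
`KAExceptional` / `KMV2000.MomentAsymptoticsLogWindowTwoBranch`): the table must carry `σ_D` (or
`L'(1,χ_D)`) as an argument; G-24 (C4′ slack = the comparison scale). Why novel (card; critics A/B): GS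
Thm 1, Granville–Stark 2000, MV 2007 §11.2, Koukoulopoulos 2013 are located; nobody located parametrises
the exceptional FAMILY term by the reduced-form sum / pretentious distance or audits dial-invariance.
Falsifiers: F1 pencil (σ-dependence of the K-I8-1 residue table), F2 «(A) ⇒ Σ_{p≤D}(1+χ_D(p))/p = o(ll D)»
in print (none found), F3 prove this lemma (elementary, M-sized; optional). A PREDICATE in `(ε, C₁)`;
nothing asserted; typed ≠ proved. [cite: GoldfeldSchinzel1975, Thm 1]
[cite: MontgomeryVaughan2007, §11.2 (11.10) p. 277] [cite: IwaniecConversations2006, §8 (8.5)–(8.6) p. 98] -/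
def DialLemma (ε C₁ : ℝ) : Prop :=
  ∃ C : ℝ, ∃ D₀ : ℕ, ∀ (D : ℕ) [NeZero D] (χ : DirichletCharacter ℂ D), D₀ ≤ D → χ.IsPrimitive →
    MulChar.IsQuadratic χ → (χ.LFunction 1).re * (10 * C₁ * Real.log D) ≤ 1 →
      ∀ x : ℕ, (D : ℝ) ^ (1 + ε) ≤ x → (x : ℝ) ≤ (D : ℝ) ^ C₁ →
        |splitMass χ x - Real.log ((deriv χ.LFunction 1).re)| ≤ C

/-- **K-I8-6 DIAL LOWER END (shape, NOT proved here).** Under the same smallness of `L(1,χ)` against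
`log D`, `L'(1,χ) ≥ 4/5` (the `n = 1` term of the positive sum `Σ (1∗χ)(n)/n`; corrects gen-0 K-I8-1's
range «`L'(β) ∈ [c, C log D]`» to `[4/5, C log² D]`). A PREDICATE in `C₁`; nothing asserted.
[cite: MontgomeryVaughan2007, §11.2 p. 277] -/
def DialLowerEnd (C₁ : ℝ) : Prop :=
  ∃ D₀ : ℕ, ∀ (D : ℕ) [NeZero D] (χ : DirichletCharacter ℂ D), D₀ ≤ D → χ.IsPrimitive →
    MulChar.IsQuadratic χ → (χ.LFunction 1).re * (10 * C₁ * Real.log D) ≤ 1 →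
      (4 : ℝ) / 5 ≤ (deriv χ.LFunction 1).re

/-- **K-I8-6, the conditional by-product (β) as a shape: «(A)_A ⇒ DIAL CEILING `L'(1,χ_D) ≤ bound D`».**
The card's dichotomy for a two-branch K_A whose exceptional term is `𝓔 = |R_{χ_D}|²·Φ` with `Φ` σ-free and
bounded: either (α) the instrument is INCOMPLETE (a σ-free companion main term must appear), or (β) the
door technology proves a HEEGNER-STRUCTURE THEOREM for Siegel zeros — `(A) ⇒ σ_D = O(1)` in the power
window (Heegner pole forced: `bound D = σ₀` constant), `(A) ⇒ σ_D ≤ (log D/ll D)^{1/2+o(1)}` in K6-1's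
sliver, `(A) ⇒ σ_D ≤ (log D)^{2+o(1)}/…` in K-I8-7's sliver edition (β′) — here with
`σ_D ↔ (6/π²)·L'(1,χ_D)` and a general ceiling `bound : ℕ → ℝ`. A PREDICATE in `(A, bound)`; NOT
ASSERTED (neither (α) nor (β) is decided by typing); typed ≠ proved.
[cite: IwaniecConversations2006, §9 (9.6) and §8 (8.5)–(8.6)] -/
def DialCeilingUnderA (A : ℕ) (bound : ℕ → ℝ) : Prop :=
  ∃ D₀ : ℕ, ∀ (D : ℕ) [NeZero D] (χ : DirichletCharacter ℂ D), D₀ ≤ D → χ.IsPrimitive →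
    MulChar.IsQuadratic χ → (χ.LFunction 1).re < ((Real.log D) ^ A)⁻¹ →
      (deriv χ.LFunction 1).re ≤ bound D

/-- Bookkeeping (proved): a dial ceiling is monotone in the ceiling (eventual domination suffices).
[cite: IwaniecConversations2006, §9 (9.6)] -/
theorem DialCeilingUnderA.mono {A : ℕ} {b b' : ℕ → ℝ} (h : DialCeilingUnderA A b)
    (hbb : ∃ D₁ : ℕ, ∀ D : ℕ, D₁ ≤ D → b D ≤ b' D) : DialCeilingUnderA A b' := by
  obtain ⟨D₀, H⟩ := h
  obtain ⟨D₁, hD₁⟩ := hbb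
  refine ⟨max D₀ D₁, fun D _ χ hD hprim hquad hA ↦ ?_⟩
  exact (H D χ (le_trans (le_max_left _ _) hD) hprim hquad hA).trans
    (hD₁ D (le_trans (le_max_right _ _) hD))

/-- Bookkeeping (proved): a dial ceiling in a deeper (A)-world (larger exponent `A' ≥ A`, a STRONGER
smallness hypothesis on `L(1,χ)`) follows from the ceiling at `A` (for `D ≥ 3`, `log D ≥ 1`).
[cite: IwaniecConversations2006, §9 (9.6)] -/
theorem DialCeilingUnderA.of_le {A A' : ℕ} {b : ℕ → ℝ} (h : DialCeilingUnderA A b) (hAA : A ≤ A') :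
    DialCeilingUnderA A' b := by
  obtain ⟨D₀, H⟩ := h
  refine ⟨max D₀ 3, fun D _ χ hD hprim hquad hA ↦ H D χ (le_trans (le_max_left _ _) hD) hprim hquad
    (lt_of_lt_of_le hA ?_)⟩
  have hD3 : (3 : ℝ) ≤ D := by exact_mod_cast le_trans (le_max_right _ _) hD
  have hlog : 1 ≤ Real.log D := by
    rw [← Real.log_exp 1]
    exact Real.log_le_log (Real.exp_pos 1) (le_trans (by linarith [Real.exp_one_lt_d9]) hD3)
  exact inv_anti₀ (by positivity) (pow_le_pow_right₀ hlog hAA)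

/-! ## §3 K6-4 «THREE LINES ACROSS THE DIAGONAL: complexify the log-length and ask only for NORMALITY»
(lens-6 gen 1; critics A PASS as DOOR MECHANISM in the sliver (NEEDED re-currencied to «normality» (N))
· B PASS conditional on its F1 (acq-11417 / a CFKRS-recipe computation: persistence κ = 0) · C pending).
Typed per the author's hook: an ABSTRACT family `G q : ℂ → ℂ` (the normalised complexified off-diagonal),
the three hypotheses (S) anchor / (T) trivial / (N) normality on the box, the REALISATION clause tying `G`
at the real point `w = B` to K6-1's door, the pure complex-analysis TRANSPORT as a named shape (CLAIMED,
provable), and KERNEL glue: transport-conclusion + realisation ⇒ `LogWindowUpperControl B η`, every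
`η < 4`. -/

/-- K6-4's box height `W_q := c₁ · log q̂ / log log q̂` (the imaginary range of the complex length-excess
variable `w`; the shift of Φ's argument is `Im w · L/log q̂ ≤ c₁`, so no growth of the coefficients on the
box). A DEFINITION. [cite: KowalskiMichelVanderKam2000, p. 28 L73–L77] -/
def boxHeight (c₁ : ℝ) (q : ℕ) : ℝ :=
  c₁ * Real.log (qhat q) / Real.log (Real.log (qhat q))

/-- **K6-4 (S) ANCHOR — theorem side, LEFT edge `Re w = −w₀` (inside the diagonal).** On the left edge of
the box `R_q = {−w₀ ≤ Re w ≤ B+1, |Im w| ≤ W_q}` the normalised complexified off-diagonal is small: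
`sup |G_q| ≤ a_q := (log q̂)^{−a}` (card: `a = 2w₀ − c₀`; inside the diagonal the off-diagonal is
`≪ (M/q̂)²(log q)^{c₀}·second` with complex-twisted bounded coefficients — VanderKam Lemma 3.3/3.4 made
polylog-clean and δ-UNIFORM as `δ → 0`, the card's falsifier F2 = acq-13313). A PREDICATE in
`(G, w₀, a, c₁)`; nothing asserted. [cite: KowalskiMichelVanderKam2000, Lemma 3.3 p. 8 L60–L66 and p. 9 L1–L12] -/
def AnchorEdge (G : ℕ → ℂ → ℂ) (w₀ a c₁ : ℝ) : Prop :=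
  ∃ q₁ : ℕ, ∀ q : ℕ, q.Prime → q₁ ≤ q → ∀ w : ℂ, w.re = -w₀ → |w.im| ≤ boxHeight c₁ q →
    ‖G q w‖ ≤ Real.log (qhat q) ^ (-a)

/-- **K6-4 (T) TRIVIAL bound everywhere on the box** (Poisson count, no cancellation):
`|G_q(w)| ≤ (log q̂)^{c₂}` for `−w₀ ≤ Re w ≤ B + 1`, `|Im w| ≤ W_q` (card: `c₂ ≈ 2(B+1) + c₀`). A PREDICATE in
`(G, w₀, B, c₂, c₁)`; nothing asserted. [cite: KowalskiMichelVanderKam2000, §6 p. 19] -/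
def TrivialOnBox (G : ℕ → ℂ → ℂ) (w₀ B c₂ c₁ : ℝ) : Prop :=
  ∃ q₁ : ℕ, ∀ q : ℕ, q.Prime → q₁ ≤ q → ∀ w : ℂ, -w₀ ≤ w.re → w.re ≤ B + 1 →
    |w.im| ≤ boxHeight c₁ q → ‖G q w‖ ≤ Real.log (qhat q) ^ c₂

/-- **K6-4 (N) NORMALITY CRUX — RIGHT edge `Re w = B + 1` (one unit past the window):**
`sup_{Re w = B+1, |Im w| ≤ W_q} |G_q(w)| ≤ C` for SOME constant `C < ∞`, all large prime `q`. This is the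
card's whole beyond-diagonal requirement: NO numerical constant, NO sign — boundedness of the normalised
complexified off-diagonal at complex log-lengths one unit past the window (the least requirement in the
CONSTANT currency; W-PV evaded in currency, NOT in substance: (N) still asserts cancellation by a factor
`≍ (log q)^{2B+2+c₀}/C` beyond Parseval, ref-B 18:24:30Z). A-WORLD SIGNATURE (card): IS + (A) force
`G_q(t) ≥ c·t` on the real window at compatible `q`, so `{G_q}` is NON-NORMAL exactly in the A-world —
(N) is ¬(A)-complete as a door input must be. A PREDICATE in `(G, B, C, c₁)`; nothing asserted; typed ≠
proved. [cite: KowalskiMichelVanderKam2000, p. 28 L73–L77] -/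
def NormalBeyond (G : ℕ → ℂ → ℂ) (B C c₁ : ℝ) : Prop :=
  ∃ q₁ : ℕ, ∀ q : ℕ, q.Prime → q₁ ≤ q → ∀ w : ℂ, w.re = B + 1 → |w.im| ≤ boxHeight c₁ q →
    ‖G q w‖ ≤ C

/-- **K6-4 (R) REALISATION clause (the typer's explicit link to the door; the card's definitional
normalisation, owed as a comparison).** `G_q(w) := (S₂(q,w) − D_cont(q,w))·log q̂/(L·second_diag(q,w))`,
`L = log log q̂`, `S₂(q,w)` = the mollified harmonic second moment at prime level `q` with the COMPLEXIFIED
length `x_m(w) = μ(m)·Φ(log m/log q̂ − 1 − w·L/log q̂)·(P-weight)`, Φ a fixed entire smooth step, ENTIRE in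
`w` (finite sums). At the REAL point `w = B` the length is K6-1's `q̂^{Δ'_q}`, `Δ'_q = logWindowExponent B q`,
and `L/log q̂ = (Δ'_q − 1)/B`; this Prop says the tree's second moment at `P = X²`, `Q = 1` and that length
exceeds its continued diagonal polynomial `mainScale·second(Δ'_q)` by at most
`‖G q B‖·(L/log q̂)·mainScale·second(Δ'_q)` up to the KMV error `C·q̂·log⁻³ q̂`. HONEST GAP recorded: the
tree's `QhPQ` carries KMV's SHARP cutoff `x_m = μ(m)P(log(M/m)/log M)·𝟙_{m ≤ M}`, the card's `S₂` a
Φ-SMOOTHED one, so (R) is a comparison the card owes (or the consumer re-run for Φ-mollifiers, any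
mollifier serving the edge) — not automatic. A PREDICATE in `(G, B)`; nothing asserted.
[cite: KowalskiMichelVanderKam2000, §6 p. 19 (second-moment display) and (9)] -/
def RealisesLogWindow (G : ℕ → ℂ → ℂ) (B : ℝ) : Prop :=
  ∃ C : ℝ, ∃ q₁ : ℕ, ∀ (q : ℕ) [NeZero q], q.Prime → q₁ ≤ q →
    (∀ n : ℕ, (n : ℝ) ≠ qhat q ^ logWindowExponent B q) →
      (QhPQ q (X ^ 2) 1 (qhat q ^ logWindowExponent B q)).re ≤
        2 * (Real.pi ^ 2 / 6) ^ 2 *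
            (qhat q / (logWindowExponent B q ^ 2 * Real.log (qhat q) ^ 2)) *
            (secondMomentForm (logWindowExponent B q) (X ^ 2) 1 +
              ‖G q (B : ℂ)‖ * (Real.log (Real.log (qhat q)) / Real.log (qhat q)) *
                secondMomentForm (logWindowExponent B q) (X ^ 2) 1) +
          C * qhat q * (Real.log (qhat q))⁻¹ ^ 3

/-- **K6-4 THREE-LINES TRANSPORT on the box (pure complex analysis; CLAIMED — provable, M-sized).** For
every family of ENTIRE functions `G q` satisfying (S) with exponent `a > 0` on the left edge `Re w = −w₀`,
(T) with exponent `c₂` on the box, (N) with constant `C` on the right edge `Re w = B + 1`, box height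
`W_q = c₁ log q̂/log log q̂` with `c₁² > c₂ + a` (so the Gaussian damping `e^{ε(w−t)²}`,
`ε = L³/log² q̂`, kills the horizontal edges: `ε W_q² = c₁² L` beats the trivial-over-anchor loss
`(c₂ + a) L`), the values on the REAL WINDOW tend to zero: `|G_q(t)| → 0` for each `t ∈ [0, B]` (indeed
`≤ a_q^{1−θ(t)} C^{θ(t)} (1 + o(1)) + o(1)`, `θ(t) = (t + w₀)/(B + 1 + w₀) < 1`). Mathlib has the STRIP case
(`Complex.HadamardThreeLines.norm_le_interp_of_mem_verticalClosedStrip'`) and bounded-domain maximum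
modulus (`Complex.norm_le_of_forall_mem_frontier_norm_le`); the box-with-damping variant is routine from
the latter — glue: CLAIMED (typer may discharge as `threeLinesTransport_holds`). A PREDICATE in `(w₀, B)`
quantifying over all `G, a, c₂, C, c₁`; stated, not proved here. [cite: KowalskiMichelVanderKam2000, p. 28 L73–L77] -/
def ThreeLinesTransport (w₀ B : ℝ) : Prop :=
  ∀ (G : ℕ → ℂ → ℂ) (a c₂ C c₁ : ℝ), 0 < a → c₂ + a < c₁ ^ 2 → 0 < c₁ →
    (∀ q : ℕ, Differentiable ℂ (G q)) → AnchorEdge G w₀ a c₁ → TrivialOnBox G w₀ B c₂ c₁ →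
      NormalBeyond G B C c₁ → ∀ t : ℝ, 0 ≤ t → t ≤ B → ∀ ε : ℝ, 0 < ε →
        ∃ q₂ : ℕ, ∀ q : ℕ, q.Prime → q₂ ≤ q → ‖G q (t : ℂ)‖ ≤ ε

/-- **K6-4 glue, KERNEL: realisation + «`G_q(B) → 0` along the primes» ⇒ K6-1's one-sided log-window door
`LogWindowUpperControl B η` for EVERY `η < 4` and `B > 0`.** (The card asks only `η < ½`; the bookkeeping
gives all `η < 4`: the off-diagonal is `o((Δ'_q − 1)·second)` against a slack `(4 − η)(Δ'_q − 1)`.) Proof: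
`Δ'_q − 1 = B·L/log q̂`, `second(Δ'_q) = 4 + 4/Δ'_q ≤ 8` for `Δ'_q ≥ 1` (`q ≥ 300`), take `q` large with
`‖G q B‖ ≤ (4 − η)B/8`. [cite: KowalskiMichelVanderKam2000, §6 p. 19 (second-moment display)] -/
theorem logWindowUpperControl_of_realises {G : ℕ → ℂ → ℂ} {B η : ℝ} (hB : 0 < B) (hη : η < 4)
    (hR : RealisesLogWindow G B)
    (h0 : ∀ ε : ℝ, 0 < ε → ∃ q₂ : ℕ, ∀ q : ℕ, q.Prime → q₂ ≤ q → ‖G q (B : ℂ)‖ ≤ ε) :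
    LogWindowUpperControl B η := by
  obtain ⟨C, q₁, H⟩ := hR
  have h4η : 0 < 4 - η := by linarith
  have hε : 0 < (4 - η) * B / 8 := by positivity
  obtain ⟨q₂, h2⟩ := h0 ((4 - η) * B / 8) hε
  refine ⟨C, max (max q₁ q₂) 300, fun q _ hq hq₀ hgen ↦ ?_⟩
  have hq₁ : q₁ ≤ q := le_trans (le_trans (le_max_left _ _) (le_max_left _ _)) hq₀
  have hq₂ : q₂ ≤ q := le_trans (le_trans (le_max_right _ _) (le_max_left _ _)) hq₀
  have h300 : 300 ≤ q := le_trans (le_max_right _ _) hq₀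
  have hlog : 1 ≤ Real.log (qhat q) := one_le_log_qhat h300
  have hlogpos : 0 < Real.log (qhat q) := by linarith
  have hL : 0 ≤ Real.log (Real.log (qhat q)) := Real.log_nonneg hlog
  have hr : 0 ≤ Real.log (Real.log (qhat q)) / Real.log (qhat q) := div_nonneg hL hlogpos.le
  have hqhat : 0 < qhat q := qhat_pos (le_trans (by norm_num) h300)
  have hΔm1 : logWindowExponent B q - 1 = B * (Real.log (Real.log (qhat q)) / Real.log (qhat q)) := by
    rw [logWindowExponent]; ring
  have hΔ1 : 1 ≤ logWindowExponent B q := by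
    have : 0 ≤ B * (Real.log (Real.log (qhat q)) / Real.log (qhat q)) := mul_nonneg hB.le hr
    linarith
  have hΔpos : 0 < logWindowExponent B q := by linarith
  have hsec8 : secondMomentForm (logWindowExponent B q) (X ^ 2) 1 ≤ 8 := by
    rw [secondMomentForm_X_sq_one]
    have : 4 / logWindowExponent B q ≤ 4 := by
      rw [div_le_iff₀ hΔpos]; nlinarith
    linarith
  have hsec0 : 0 ≤ secondMomentForm (logWindowExponent B q) (X ^ 2) 1 := by
    rw [secondMomentForm_X_sq_one]; positivity
  have hms : 0 ≤ 2 * (Real.pi ^ 2 / 6) ^ 2 *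
      (qhat q / (logWindowExponent B q ^ 2 * Real.log (qhat q) ^ 2)) := by positivity
  have hG : ‖G q (B : ℂ)‖ ≤ (4 - η) * B / 8 := h2 q hq hq₂
  have key : ‖G q (B : ℂ)‖ * (Real.log (Real.log (qhat q)) / Real.log (qhat q)) *
      secondMomentForm (logWindowExponent B q) (X ^ 2) 1 ≤
        (4 - η) * (logWindowExponent B q - 1) := by
    rw [hΔm1]
    have e1 : ‖G q (B : ℂ)‖ * (Real.log (Real.log (qhat q)) / Real.log (qhat q)) ≤
        (4 - η) * B / 8 * (Real.log (Real.log (qhat q)) / Real.log (qhat q)) :=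
      mul_le_mul_of_nonneg_right hG hr
    have e2 := mul_le_mul e1 hsec8 hsec0 (mul_nonneg hε.le hr)
    calc _ ≤ (4 - η) * B / 8 * (Real.log (Real.log (qhat q)) / Real.log (qhat q)) * 8 := e2
      _ = (4 - η) * (B * (Real.log (Real.log (qhat q)) / Real.log (qhat q))) := by ring
  calc (QhPQ q (X ^ 2) 1 (qhat q ^ logWindowExponent B q)).re
      ≤ 2 * (Real.pi ^ 2 / 6) ^ 2 *
            (qhat q / (logWindowExponent B q ^ 2 * Real.log (qhat q) ^ 2)) *
            (secondMomentForm (logWindowExponent B q) (X ^ 2) 1 +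
              ‖G q (B : ℂ)‖ * (Real.log (Real.log (qhat q)) / Real.log (qhat q)) *
                secondMomentForm (logWindowExponent B q) (X ^ 2) 1) +
          C * qhat q * (Real.log (qhat q))⁻¹ ^ 3 := H q hq hq₁ hgen
    _ ≤ _ := by
      have := mul_le_mul_of_nonneg_left (add_le_add_left key
        (secondMomentForm (logWindowExponent B q) (X ^ 2) 1)) hms
      linarith

/-- **K6-4 end-to-end, KERNEL modulo the named shapes: three-lines transport + (S) + (T) + (N) +
realisation ⇒ `LogWindowUpperControl B η`** (K6-1's one-sided log-window door, deck 2 §1, whose consumer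
`CentralValueFamily.lOne_lowerBound_of_EStarFamLog` (p553194) is the sliver edge), for all `η < 4`,
`0 < B`. The card's NET TRADE made checkable: «one-sided, specific constant `< ½·(Δ'−1)`» ↦ «two-sided
modulus `≤` ANY constant `C` at complex log-lengths one unit past the window» + the anchor's δ-uniformity
(F2) + the smoothed-vs-sharp realisation. [cite: KowalskiMichelVanderKam2000, §6 p. 19 and p. 28 L73–L77] -/
theorem logWindowUpperControl_of_threeLines {G : ℕ → ℂ → ℂ} {w₀ B a c₂ C c₁ η : ℝ}
    (hT : ThreeLinesTransport w₀ B) (hB : 0 < B) (hη : η < 4) (ha : 0 < a) (hc : c₂ + a < c₁ ^ 2)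
    (hc₁ : 0 < c₁) (hG : ∀ q : ℕ, Differentiable ℂ (G q)) (hS : AnchorEdge G w₀ a c₁)
    (hTr : TrivialOnBox G w₀ B c₂ c₁) (hN : NormalBeyond G B C c₁) (hR : RealisesLogWindow G B) :
    LogWindowUpperControl B η :=
  logWindowUpperControl_of_realises hB hη hR (hT G a c₂ C c₁ ha hc hc₁ hG hS hTr hN B hB.le le_rfl)

/-! ## §4 K-L7-4′ «LOCALISED SQUEEZE — the triage number the R** evaluation must hit» (lens-7 gen 3,
§v3 V3-1; critic B PASS bookkeeping (batch 19); bookkeeping-grade delta over deck 2 §7's parity squeeze,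
G-24 context). The card's algebra PROVED: in K_B currency `τ := OD₂/second_diag`, with
`V := Δ'/(2(1+Δ')(1+τ))` the mollified value and `p₁ = 2V ≤ ½ + d` at a compatible level in the
(A)-world (the card's INPUT, a hypothesis here), one gets `τ ≥ [Δ' − 1 − 2d(1+Δ')]/[(1+Δ')(1+2d)]
≥ (Δ'−1)/(1+Δ') − 4d` — the door's generic margin minus `O(d)`. Nothing about L-functions asserted. -/

/-- **K-L7-4′ (V3-1): the localised squeeze, exact form.** If `1 + τ > 0`, `1 + 2d > 0`, `Δ' > 0` and
the mollified value `V = Δ'/(2(1+Δ')(1+τ))` satisfies `V ≤ ¼ + d/2` (i.e. `p₁ = 2V ≤ ½ + d`), then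
`τ ≥ (Δ' − 1 − 2d(1+Δ'))/((1+Δ')(1+2d))`. Pure algebra (the card's «algebra from V ≤ ¼ + d/2»).
[cite: KowalskiMichelVanderKam2000, Thm. 6.1 (32)] -/
theorem localisedSqueeze_tau_lowerBound {Δ' τ d : ℝ} (hΔ : 0 < Δ') (hτ : 0 < 1 + τ)
    (hd : 0 < 1 + 2 * d) (hV : Δ' / (2 * (1 + Δ') * (1 + τ)) ≤ 1 / 4 + d / 2) :
    (Δ' - 1 - 2 * d * (1 + Δ')) / ((1 + Δ') * (1 + 2 * d)) ≤ τ := by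
  have h1 : 0 < 1 + Δ' := by linarith
  have hden : 0 < 2 * (1 + Δ') * (1 + τ) := by positivity
  rw [div_le_iff₀ hden] at hV
  rw [div_le_iff₀ (by positivity)]
  nlinarith [mul_pos h1 hd, mul_pos h1 hτ]

/-- **K-L7-4′ (V3-1): the localised squeeze in margin form** — the exact bound is at least the door's
generic margin `(Δ'−1)/(1+Δ')` minus `4d` (for `0 ≤ d`, `Δ' ≥ 1`); with `τ = τ_gen + τ_{R**}` this is
the card's «`τ_{R**}^{(A)} ≥ margin − τ_gen − O(d)`». Pure algebra.
[cite: KowalskiMichelVanderKam2000, Thm. 6.1 (32)] -/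
theorem localisedSqueeze_margin_form {Δ' d : ℝ} (hΔ : 1 ≤ Δ') (hd : 0 ≤ d) :
    (Δ' - 1) / (1 + Δ') - 4 * d ≤ (Δ' - 1 - 2 * d * (1 + Δ')) / ((1 + Δ') * (1 + 2 * d)) := by
  have h1 : 0 < 1 + Δ' := by linarith
  have h2 : 0 < 1 + 2 * d := by linarith
  rw [div_sub' (ne_of_gt h1), div_le_div_iff₀ h1 (mul_pos h1 h2)]
  nlinarith [mul_nonneg hd (sub_nonneg.2 hΔ), mul_nonneg hd hd, mul_pos h1 h1,
    mul_nonneg (mul_nonneg hd hd) (le_of_lt h1)]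

/-- **K-L7-4′ (V3-1), the triage split (bookkeeping, proved):** with `τ = τ_gen + τ_R` the exact
squeeze reads `τ_R ≥ (Δ'−1)/(1+Δ') − 4d − τ_gen` — outcomes of an explicit (A)-world evaluation of
`R**` are PRE-SORTED against this number (HORN 1 / HORN 2 of the card). Pure algebra.
[cite: KowalskiMichelVanderKam2000, Thm. 6.1 (32)] -/
theorem localisedSqueeze_triage {Δ' τgen τR d : ℝ} (hΔ : 1 ≤ Δ') (hτ : 0 < 1 + (τgen + τR))
    (hd : 0 ≤ d) (hV : Δ' / (2 * (1 + Δ') * (1 + (τgen + τR))) ≤ 1 / 4 + d / 2) :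
    (Δ' - 1) / (1 + Δ') - 4 * d - τgen ≤ τR := by
  have := (localisedSqueeze_margin_form hΔ hd).trans
    (localisedSqueeze_tau_lowerBound (by linarith) hτ (by linarith) hV)
  linarith

end Summit.Parity.GeneralizedHardyLittlewood.Theorems.PrimeLevelFamEdgeIdeaDeltas
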